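import Summits.ResolutionOfSingularities.ResolutionOfSingularities.Theorems.HilbertSamuelEliminationSigmaMaxModificationsCorridor3SigmaMenuSurfaceCureStepLaws
import Summits.ResolutionOfSingularities.ResolutionOfSingularities.Theorems.HilbertSamuelEliminationSigmaMaxModificationsCorridor3SigmaSurfaceBadnessTrueSet
import HarnessLib

/-!
# [OURS · L1 W4.2] σ-LAYER PHASE B′ — `Corridor3SigmaMenuSurfaceExhaustive`: EXHAUSTIVENESS OF THE (P1*) CASE RULE OF RECORD — «silent ⇒ READY» (DESIGN CHECK 1, by name)
# (crux chain w42 `SigmaMaxModifications` stmt-ResolutionOfSingularities-18506 / conjunct `SigmaMaxModificationsCorridor3` stmt-ResolutionOfSingularities-19249;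
# res-L1-w42-stub-1 (gen 6); `--supports stmt-…-19249 --as helper`, counted 0)

HONEST FRAMING. OURS bookkeeping composing res-L1-type-o1's case rule `SurfacePrep.ofRecord regular phaseS badGatedOfRecord cureStepOfRecord pointStepOfRecord` (p543457,
p564099), this seat's speech laws (`exists_cureStepOfRecord_iff_badOfRecord_pos` p571643, `exists_pointStepOfRecord_of_not_isSNC'` p556167 — the latter CONDITIONAL on
F-75c `Stacks0BIC_embeddedResolutionCurvesInSurfaces_locus`, taken as a hypothesis `hF`) and the nodup-free converse (R-a) (`readyOfRecord_and_nodupNE_of_badOfRecord_eq_zero`,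
p573186). NOTHING here is a statement of H. Hironaka's manuscript [Hironaka2017] nor of [CossartJannsenSaito2020]. AI-typed; AI review is weaker than expert review.

* **`surfaceSncLength_eq_zero_and_badOfRecord_eq_zero_of_forall_not_ofRecord`**: on an irreducible surface with `D̃` Noetherian regular excellent two-dimensional and
  `regular W D`, if the prep oracle of record proposes NO centre then `ℓ(E, D) = 0` and `M(E, D) = 0` (`ℓ > 0` would make the point step speak behind the closed gate,
  `ℓ = 0 < M` the cure behind the open gate).
* **`readyOfRecord_and_nodupNE_of_forall_not_ofRecord`** (+ `_of_mem_surfaceComponents`): … hence the surface is READY — rev-1 readiness `ReadyOfRecord` (regular ∧ filtered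
  traces snc as a list) AND the repaired true-set clause (TS′) «no repeated non-empty trace» — for ANY readings `regular`, `phaseS`, members locally principal.
* **`exists_ofRecord_or_ready_of_mem_surfaceComponents`**: the DICHOTOMY OF RECORD on a surface component of `X(ν)`: the oracle speaks, or the surface is READY (TS′ form).
  (With res-type-067's typed `ReadyTSOfRecord` the dichotomy is FALSE on surfaces missed by two boundary members — `not_readyTSOfRecord_of_pair_disjoint`; it holds for
  the typed predicate when no member misses `D`: `exists_ofRecord_or_readyTS_of_forall_ne_top`.)

VACUITY SELF-CHECK. `hsilent` is satisfiable (e.g. `E = []`, `D` a regular surface: all three sub-oracles are silent) and then the conclusion is the non-trivial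
«`[]`-READY»; F-75c enters only through `hF`.
-/

noncomputable section

set_option linter.dupNamespace false -- mandated namespace of this single-conjunct summit

open CategoryTheory AlgebraicGeometry TopologicalSpace IsLocalRing
open Summit.ResolutionOfSingularities.ResolutionOfSingularities.Theorems.CampaignW42
open Literature.AlgebraicGeometry.Resolution Literature.RingTheory.HilbertSamuel

namespace Summit.ResolutionOfSingularities.ResolutionOfSingularities.Theorems.SigmaMaxModificationsCorridor3.Sigma

universe u

open Scheme.IdealSheafData

variable {W : Scheme.{u}} {hW : IsLocallyNoetherian W} {N : ℕ} {ν : ℕ → ℕ} {L : Labelling W} {P : Option (Pending W)} {E : Boundary W} {D : Closeds W}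

/-- **SILENT ⇒ `ℓ = 0 ∧ M = 0`** on a regular irreducible surface with `D̃` Noetherian regular excellent of dimension `2` (F-75c for the point step's speech).
[folklore] -/
theorem surfaceSncLength_eq_zero_and_badOfRecord_eq_zero_of_forall_not_ofRecord (hF : Stacks0BIC_embeddedResolutionCurvesInSurfaces_locus.{u})
    [AlgebraicGeometry.IsNoetherian (menuCentre D).subscheme] {regular : SurfaceRegularity.{u}} {phaseS : SurfacePrep.{u}}
    (hsilent : ∀ C : W.IdealSheafData, ¬ SurfacePrep.ofRecord regular phaseS badGatedOfRecord cureStepOfRecord pointStepOfRecord W hW N ν L P E D C)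
    (hr : regular W D) (hDirr : IsIrreducible (D : Set W)) (hreg : Scheme.IsRegular (menuCentre D).subscheme) (hexc : Scheme.IsExcellent (menuCentre D).subscheme)
    (hdim : topologicalKrullDim ↥(menuCentre D).subscheme = 2) : surfaceSncLength E D = 0 ∧ badOfRecord W E D = 0 := by
  have hℓ : surfaceSncLength E D = 0 := by
    by_contra hne
    have hpos : 0 < surfaceSncLength E D := Nat.pos_of_ne_zero hne
    have hnot := (surfaceSncLength_pos_iff' hF E D hDirr hreg hexc hdim).mp hpos
    obtain ⟨C, hC⟩ := exists_pointStepOfRecord_of_not_isSNC' hF (hW := hW) (N := N) (ν := ν) (L := L) (P := P) E D hDirr hreg hexc hdim hnot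
    exact hsilent C (SurfacePrep.ofRecord_of_point hr ((badGatedOfRecord_eq_zero_iff E D).mpr (Or.inl hpos)) hC)
  refine ⟨hℓ, ?_⟩
  by_contra hM
  obtain ⟨C, hC⟩ := (exists_cureStepOfRecord_iff_badOfRecord_pos (hW := hW) (N := N) (ν := ν) (L := L) (P := P) (E := E) hDirr hdim.le).mpr
    (Nat.pos_of_ne_zero hM)
  exact hsilent C (SurfacePrep.ofRecord_of_cure hr ((badGatedOfRecord_pos_iff E D).mpr ⟨hℓ, Nat.pos_of_ne_zero hM⟩) hC)

open scoped Classical in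
/-- **EXHAUSTIVENESS OF THE CASE RULE OF RECORD: SILENT ⇒ READY (TS′ form).** For ANY readings `regular`, `phaseS`: on an irreducible surface with `D̃` Noetherian regular
excellent two-dimensional, `regular W D`, boundary members locally principal, if `SurfacePrep.ofRecord regular phaseS badGatedOfRecord cureStepOfRecord pointStepOfRecord`
proposes no centre then `D` is READY — `ReadyOfRecord W E N ν D` and no repeated non-empty trace. DESIGN CHECK 1 closed by name (modulo F-75c). [folklore] -/
theorem readyOfRecord_and_nodupNE_of_forall_not_ofRecord (hF : Stacks0BIC_embeddedResolutionCurvesInSurfaces_locus.{u})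
    [AlgebraicGeometry.IsNoetherian (menuCentre D).subscheme] {regular : SurfaceRegularity.{u}} {phaseS : SurfacePrep.{u}}
    (hsilent : ∀ C : W.IdealSheafData, ¬ SurfacePrep.ofRecord regular phaseS badGatedOfRecord cureStepOfRecord pointStepOfRecord W hW N ν L P E D C)
    (hr : regular W D) (hDirr : IsIrreducible (D : Set W)) (hreg : Scheme.IsRegular (menuCentre D).subscheme) (hexc : Scheme.IsExcellent (menuCentre D).subscheme)
    (hdim : topologicalKrullDim ↥(menuCentre D).subscheme = 2) (hE : ∀ B ∈ E, IsLocallyPrincipal B) :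
    ReadyOfRecord W E N ν D ∧ ((E.restrictOff (menuCentre D).subschemeι).filter fun Γ => Γ ≠ ⊤).Nodup := by
  obtain ⟨hℓ, hM⟩ := surfaceSncLength_eq_zero_and_badOfRecord_eq_zero_of_forall_not_ofRecord hF hsilent hr hDirr hreg hexc hdim
  exact readyOfRecord_and_nodupNE_of_badOfRecord_eq_zero_of_stacks0BIC hF hreg hDirr hexc hdim hE hℓ hM

open scoped Classical in
/-- **… ON A SURFACE COMPONENT OF `X(ν)`** (`D ∈ surfaceComponents W N ν` supplies irreducibility and `dim D̃ = 2`; binders of o1's oracle laws). [folklore] -/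
theorem readyOfRecord_and_nodupNE_of_forall_not_ofRecord_of_mem_surfaceComponents (hF : Stacks0BIC_embeddedResolutionCurvesInSurfaces_locus.{u})
    [AlgebraicGeometry.IsNoetherian (menuCentre D).subscheme] {regular : SurfaceRegularity.{u}} {phaseS : SurfacePrep.{u}}
    (hD : (D : Set W) ∈ surfaceComponents W N ν)
    (hsilent : ∀ C : W.IdealSheafData, ¬ SurfacePrep.ofRecord regular phaseS badGatedOfRecord cureStepOfRecord pointStepOfRecord W hW N ν L P E D C)
    (hr : regular W D) (hreg : Scheme.IsRegular (menuCentre D).subscheme) (hexc : Scheme.IsExcellent (menuCentre D).subscheme) (hE : ∀ B ∈ E, IsLocallyPrincipal B) :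
    ReadyOfRecord W E N ν D ∧ ((E.restrictOff (menuCentre D).subschemeι).filter fun Γ => Γ ≠ ⊤).Nodup :=
  readyOfRecord_and_nodupNE_of_forall_not_ofRecord hF hsilent hr (componentsIn.isIrreducible hD.1) hreg hexc
    (topologicalKrullDim_menuCentre_subscheme_of_mem_surfaceComponents hD) hE

open scoped Classical in
/-- **THE DICHOTOMY OF RECORD ON A SURFACE COMPONENT**: with `D̃` Noetherian regular excellent, `regular W D` and locally principal members, EITHER the prep oracle of record
proposes a centre OR the surface is READY (TS′ form). [folklore] -/
theorem exists_ofRecord_or_ready_of_mem_surfaceComponents (hF : Stacks0BIC_embeddedResolutionCurvesInSurfaces_locus.{u})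
    [AlgebraicGeometry.IsNoetherian (menuCentre D).subscheme] {regular : SurfaceRegularity.{u}} {phaseS : SurfacePrep.{u}}
    (hD : (D : Set W) ∈ surfaceComponents W N ν) (hr : regular W D) (hreg : Scheme.IsRegular (menuCentre D).subscheme)
    (hexc : Scheme.IsExcellent (menuCentre D).subscheme) (hE : ∀ B ∈ E, IsLocallyPrincipal B) :
    (∃ C : W.IdealSheafData, SurfacePrep.ofRecord regular phaseS badGatedOfRecord cureStepOfRecord pointStepOfRecord W hW N ν L P E D C) ∨
      (ReadyOfRecord W E N ν D ∧ ((E.restrictOff (menuCentre D).subschemeι).filter fun Γ => Γ ≠ ⊤).Nodup) := by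
  by_cases h : ∃ C : W.IdealSheafData, SurfacePrep.ofRecord regular phaseS badGatedOfRecord cureStepOfRecord pointStepOfRecord W hW N ν L P E D C
  · exact Or.inl h
  · exact Or.inr (readyOfRecord_and_nodupNE_of_forall_not_ofRecord_of_mem_surfaceComponents hF hD (not_exists.mp h) hr hreg hexc hE)

/-- **… AND FOR THE TYPED `ReadyTSOfRecord` WHEN NO MEMBER MISSES `D`** (every filtered trace `≠ ⊤`). [folklore] -/
theorem exists_ofRecord_or_readyTS_of_forall_ne_top (hF : Stacks0BIC_embeddedResolutionCurvesInSurfaces_locus.{u})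
    [AlgebraicGeometry.IsNoetherian (menuCentre D).subscheme] {regular : SurfaceRegularity.{u}} {phaseS : SurfacePrep.{u}}
    (hD : (D : Set W) ∈ surfaceComponents W N ν) (hr : regular W D) (hreg : Scheme.IsRegular (menuCentre D).subscheme)
    (hexc : Scheme.IsExcellent (menuCentre D).subscheme) (hE : ∀ B ∈ E, IsLocallyPrincipal B)
    (htop : ∀ Γ ∈ E.restrictOff (menuCentre D).subschemeι, Γ ≠ ⊤) :
    (∃ C : W.IdealSheafData, SurfacePrep.ofRecord regular phaseS badGatedOfRecord cureStepOfRecord pointStepOfRecord W hW N ν L P E D C) ∨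
      ReadyTSOfRecord W E N ν D := by
  by_cases h : ∃ C : W.IdealSheafData, SurfacePrep.ofRecord regular phaseS badGatedOfRecord cureStepOfRecord pointStepOfRecord W hW N ν L P E D C
  · exact Or.inl h
  · have hdim := topologicalKrullDim_menuCentre_subscheme_of_mem_surfaceComponents hD
    have hDirr := componentsIn.isIrreducible hD.1
    obtain ⟨hℓ, hM⟩ := surfaceSncLength_eq_zero_and_badOfRecord_eq_zero_of_forall_not_ofRecord hF (not_exists.mp h) hr hDirr hreg hexc hdim
    exact Or.inr (readyTSOfRecord_of_badOfRecord_eq_zero_of_forall_ne_top hreg hDirr hdim.le hE htop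
      (exists_existsPointCompositionN_of_isClosed_of_stacks0BIC_locus hF _ hreg hexc hdim (isClosed_surfaceTraceSet E D)
        (isNowhereDense_surfaceTraceSet E hDirr)) hℓ hM)

end Summit.ResolutionOfSingularities.ResolutionOfSingularities.Theorems.SigmaMaxModificationsCorridor3.Sigma

end
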